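import Mathlib
import HarnessLib

/-!
# The contraction step of the uniform discrete boundary Harnack principle
# (Chelkak–Wan 2021, Lemma 3.7 ⇒ Corollary 3.8): the algebraic skeleton

Topic `Literature/Probability/LatticeModels`; theorems only (no definitions, no named facts).
D. Chelkak, Y. Wan, *On the convergence of massive loop-erased random walks to massive SLE(2)
curves*, Electron. J. Probab. 26 (2021), paper 54 = arXiv:1903.08045, §3.2 (source read:
`lit read arxiv:1903.08045`, pp. 15–16 of the text rendering), prove the uniform boundary Harnack
principle (Cor. 3.8, vendored in vertex form as the named fact `ChelkakWan_uniformBoundaryHarnack`,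
`DiscreteBoundaryHarnack.lean`) by iterating a ONE-STEP CONTRACTION (Lemma 3.7): for two positive
discrete harmonic functions `H₁, H₂` with Dirichlet conditions near the boundary point `b`, the
symmetrised oscillation
`M(S) = max_{x,y ∈ S} |H₁(x)H₂(y) − H₁(y)H₂(x)| / (H₁(x)H₂(y) + H₁(y)H₂(x))`
contracts by a universal factor `k < 1` when one passes from the vertices `S^δ_o(b,r⁺)` outside the
cross-cut at scale `r` to the region `Θ^δ(r/2)` inside the cross-cut at scale `r/2`. Their proof has
two halves:

* an ALGEBRAIC half (ibid., proof of Lemma 3.7, first display to eq. (3.6)): writing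
  `H_i(u) = Σ_x K(u,x) H_i(x)` (Markov property at the cross-cut; `K(u,x) = Z_{Θ(r)}(u,x)`, further
  decomposed through the last visit to `Θ(r/2)` as the mixture `Σ_{u'} Z_{Θ(r)}(u,u') Z_{Λ(r)}(u',x)`),
  "applying this identity four times and rearranging terms one sees that" the contraction by
  `k` follows from the two-sided bound
  `|Z_Λ(u',x)Z_Λ(v',y) − Z_Λ(u',y)Z_Λ(v',x)| ≤ k (Z_Λ(u',x)Z_Λ(v',y) + Z_Λ(u',y)Z_Λ(v',x))`, i.e. from
  a uniform bound `C = (1+k)/(1−k)` on the "cross-ratios" `Z(u',x)Z(v',y)/(Z(v',x)Z(u',y))` of the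
  annular kernel; and Cor. 3.8: "iterating `q` times … gives
  `|H₁(u)H₂(v) − H₂(u)H₁(v)| ≤ k^q (H₁(u)H₂(v) + H₂(u)H₁(v))`", whence
  `(H₁(u)/H₂(u))/(H₁(v)/H₂(v)) ≤ (1+k^q)/(1−k^q)`;
* an ANALYTIC half: the cross-ratio bound itself for the discrete quadrilateral `Λ^δ(r)` between two
  consecutive cross-cuts (Chelkak's toolbox, Ann. Probab. 44 (2016): factorisation Thm. 3.5,
  Prop. 4.5, Thm. 4.8/7.1, and the extremal length of the annulus).

This file PROVES the algebraic half in abstract form — arbitrary index types, a nonnegative kernel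
on a finite set of "outer" points, no random walk — so that any lattice realisation (site-killed
walks on induced subdomains of `δℤ²` as printed; the edge-killed walk on `discreteDomainGraph`
used by `MartinRatioBoundaryLimit.lean` and by crux `SAWLoopFugacityFlow.AvoidanceLimit`) only has
to supply the representation `H_i(u) = Σ_x K(u,x)H_i(x)` and the kernel cross-ratio bound:

* `abs_sub_le_of_le_mul_of_le_mul` — `a ≤ C b`, `b ≤ C a` give `|a − b| ≤ ((C−1)/(C+1)) (a + b)`;
* `crossRatio_mixture` — cross-ratio bounds with constant `C` survive nonnegative mixtures in the
  first variable (the passage from `Z_Λ(u',x)` to `K(u,x) = Σ_{u'} Z_Θ(u,u') Z_Λ(u',x)`);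
* `crossDiff_contraction` (**Lemma 3.7, algebraic core**) — representation + kernel cross-ratio
  bound `C` + outer oscillation `M` ⟹ inner oscillation `≤ ((C−1)/(C+1))·M`;
* `crossDiff_iterate` (**Cor. 3.8, iteration**) — along a chain of regions `S 0, S 1, …` with
  representations through finite sets `T j ⊆ S j`, the oscillation on `S q` is `≤ k^q`,
  `k = (C−1)/(C+1)`;
* `div_div_le_of_abs_sub_le`, `le_mul_of_abs_sub_le` — conversion of `|a − b| ≤ m (a + b)` into the
  ratio form `(H₁u/H₂u)/(H₁v/H₂v) ≤ (1+m)/(1−m)` and into the division-free form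
  `H₁(u)H₂(v) ≤ (1+η) H₁(v)H₂(u)` once `m (2+η) ≤ η` (the shape of the hypothesis `hBHP` of
  `KozdronLawler2005_martinRatioBoundaryLimit_of_uniformBHP`);
* `crossDiff_iterate_ratio` — the printed conclusion `(H₁u/H₂u)/(H₁v/H₂v) ≤ (1+k^q)/(1−k^q)`.

What is deliberately NOT here: cross-cuts, the sets `Θ^δ(r)`, `Λ^δ(r)`, `S^δ_o(b,r^±)` and the
Markov-property identities producing the representation (lattice potential theory of the killed
walk), and the analytic half (the kernel cross-ratio bound), which for rough lattice domains is the
content of Chelkak's toolbox; nothing is asserted about them.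

## References
* D. Chelkak, Y. Wan, Electron. J. Probab. 26 (2021), paper 54, arXiv:1903.08045, §3.2, Lemma 3.7
  and Corollary 3.8 with proofs — bib key `ChelkakWan2021`.
* D. Chelkak, *Robust discrete complex analysis: a toolbox*, Ann. Probab. 44 (2016) 628–683,
  arXiv:1212.6205, Thm. 3.5, Prop. 4.5, Thm. 4.8, Thm. 7.1 — bib key `Chelkak2016`.
-/

namespace Literature.Probability.LatticeModels

namespace BoundaryHarnackContraction

open Finset
open scoped BigOperators

variable {ι κ τ : Type*}

/-! ### Two-sided comparability versus the symmetrised difference -/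

/-- **Comparability ⇒ contraction of the symmetrised difference.** If `0 ≤ a ≤ C b` and
`0 ≤ b ≤ C a` with `C ≥ 1`, then `|a − b| ≤ ((C − 1)/(C + 1)) (a + b)`: a two-sided bound `C` on a
ratio is a bound `k = (C−1)/(C+1) < 1` in Chelkak–Wan's `|·−·|/(·+·)` metric.
[cite: ChelkakWan2021, proof of Lemma 3.7, eq. (3.6) ⇔ cross-ratio bound] -/
theorem abs_sub_le_of_le_mul_of_le_mul {a b C : ℝ} (hC : 1 ≤ C)
    (hab : a ≤ C * b) (hba : b ≤ C * a) :
    |a - b| ≤ (C - 1) / (C + 1) * (a + b) := by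
  have hC1 : 0 < C + 1 := by linarith
  rw [div_mul_eq_mul_div, le_div_iff₀ hC1]
  have e1 : (C - 1) * (a + b) - (a - b) * (C + 1) = 2 * (C * b - a) := by ring
  have e2 : (C - 1) * (a + b) - (b - a) * (C + 1) = 2 * (C * a - b) := by ring
  rcases le_total b a with h | h
  · rw [abs_of_nonneg (sub_nonneg.mpr h)]; linarith
  · rw [abs_of_nonpos (sub_nonpos.mpr h)]
    have : -(a - b) = b - a := by ring
    rw [this]; linarith

/-- Conversely, **contraction ⇒ comparability**: `|a − b| ≤ m (a + b)` with `m < 1` and `0 ≤ b`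
gives `a ≤ ((1 + m)/(1 − m)) b`. [cite: ChelkakWan2021, Corollary 3.8] -/
theorem le_div_mul_of_abs_sub_le {a b m : ℝ} (hm : m < 1)
    (h : |a - b| ≤ m * (a + b)) : a ≤ (1 + m) / (1 - m) * b := by
  have hm1 : 0 < 1 - m := by linarith
  have h1 : a - b ≤ m * (a + b) := (abs_le.mp h).2
  rw [div_mul_eq_mul_div, le_div_iff₀ hm1]
  nlinarith

/-- **Ratio form.** For `a₂, b₁ > 0` and
`|a₁ b₂ − b₁ a₂| ≤ m (a₁ b₂ + b₁ a₂)`, `m < 1`: `(a₁/a₂)/(b₁/b₂) ≤ (1+m)/(1−m)` — the shape of the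
conclusion of Chelkak–Wan's Cor. 3.8 with `a_i = H_i(u)`, `b_i = H_i(v)`.
[cite: ChelkakWan2021, Corollary 3.8] -/
theorem div_div_le_of_abs_sub_le {a₁ a₂ b₁ b₂ m : ℝ} (ha₂ : 0 < a₂) (hb₁ : 0 < b₁)
    (hm : m < 1) (h : |a₁ * b₂ - b₁ * a₂| ≤ m * (a₁ * b₂ + b₁ * a₂)) :
    a₁ / a₂ / (b₁ / b₂) ≤ (1 + m) / (1 - m) := by
  have key := le_div_mul_of_abs_sub_le hm h
  rw [div_div_div_eq, div_le_iff₀ (mul_pos ha₂ hb₁)]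
  calc a₁ * b₂ ≤ (1 + m) / (1 - m) * (b₁ * a₂) := key
    _ = (1 + m) / (1 - m) * (a₂ * b₁) := by ring

/-- **Division-free form.** `|a − b| ≤ m (a + b)`, `0 ≤ b`, `0 ≤ η` and `m (2 + η) ≤ η` give
`a ≤ (1 + η) b` — the shape `h₁(z) h₂(z') ≤ (1+η) h₁(z') h₂(z)` of the uniform boundary Harnack
hypothesis consumed by `KozdronLawler2005_martinRatioBoundaryLimit_of_uniformBHP`
(`MartinRatioBoundaryLimit.lean`). [cite: ChelkakWan2021, Corollary 3.8] -/
theorem le_mul_of_abs_sub_le {a b m η : ℝ} (hb : 0 ≤ b) (hη0 : 0 ≤ η)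
    (hη : m * (2 + η) ≤ η) (h : |a - b| ≤ m * (a + b)) : a ≤ (1 + η) * b := by
  have hm1 : m < 1 := by nlinarith
  have key := le_div_mul_of_abs_sub_le hm1 h
  have hcoef : (1 + m) / (1 - m) ≤ 1 + η := by
    rw [div_le_iff₀ (by linarith)]; nlinarith
  exact key.trans (mul_le_mul_of_nonneg_right hcoef hb)

/-- The trivial starting bound of the iteration: for `a, b ≥ 0`, `|a − b| ≤ 1 · (a + b)`.
[folklore] -/
theorem abs_sub_le_one_mul_add {a b : ℝ} (ha : 0 ≤ a) (hb : 0 ≤ b) :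
    |a - b| ≤ 1 * (a + b) := by
  rw [one_mul, abs_le]; constructor <;> linarith

/-! ### Cross-ratio bounds survive mixtures -/

/-- **Mixtures preserve kernel cross-ratio bounds.** If a kernel `K₂ u' x` satisfies
`K₂ u' x · K₂ v' y ≤ C · K₂ v' x · K₂ u' y` for `u', v' ∈ U`, `x, y ∈ T`, then so does every
nonnegative mixture `K u x = Σ_{u' ∈ U} W u u' · K₂ u' x` in the first variable (same `C`). In
Chelkak–Wan's proof this is the passage from the annular kernel `Z_{Λ(r)}(u',x)` to
`Z_{Θ(r)}(u,x) = Σ_{u'} Z_{Θ(r)}(u,u') Z_{Λ(r)}(u',x)` (last visit to `Θ(r/2)`).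
[cite: ChelkakWan2021, proof of Lemma 3.7] -/
theorem crossRatio_mixture (S : Set ι) (U : Finset κ) (T : Set τ) (W : ι → κ → ℝ)
    (K₂ : κ → τ → ℝ) (K : ι → τ → ℝ) {C : ℝ}
    (hW : ∀ u ∈ S, ∀ u' ∈ U, 0 ≤ W u u')
    (hK : ∀ u ∈ S, ∀ x ∈ T, K u x = ∑ u' ∈ U, W u u' * K₂ u' x)
    (h₂ : ∀ u' ∈ U, ∀ v' ∈ U, ∀ x ∈ T, ∀ y ∈ T, K₂ u' x * K₂ v' y ≤ C * (K₂ v' x * K₂ u' y)) :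
    ∀ u ∈ S, ∀ v ∈ S, ∀ x ∈ T, ∀ y ∈ T, K u x * K v y ≤ C * (K v x * K u y) := by
  intro u hu v hv x hx y hy
  rw [hK u hu x hx, hK v hv y hy, hK v hv x hx, hK u hu y hy, Finset.sum_mul_sum,
    Finset.sum_mul_sum, Finset.mul_sum]
  simp_rw [Finset.mul_sum]
  conv_rhs => rw [Finset.sum_comm]
  refine Finset.sum_le_sum fun u' hu' => Finset.sum_le_sum fun v' hv' => ?_
  have hWW : 0 ≤ W u u' * W v v' := mul_nonneg (hW u hu u' hu') (hW v hv v' hv')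
  calc W u u' * K₂ u' x * (W v v' * K₂ v' y) = W u u' * W v v' * (K₂ u' x * K₂ v' y) := by ring
    _ ≤ W u u' * W v v' * (C * (K₂ v' x * K₂ u' y)) :=
        mul_le_mul_of_nonneg_left (h₂ u' hu' v' hv' x hx y hy) hWW
    _ = C * (W v v' * K₂ v' x * (W u u' * K₂ u' y)) := by ring

/-! ### The one-step contraction (Lemma 3.7, algebraic core) -/

/-- **Chelkak–Wan's one-step contraction, algebraic core of Lemma 3.7.** Let `h_i(u) = Σ_{x ∈ T}
K(u,x) H_i(x)` (`i = 1, 2`) on a set `S` of "inner" points, with a kernel `K ≥ 0` whose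
cross-ratios over `S × T` are bounded by `C ≥ 1` (`K(u,x)K(v,y) ≤ C K(v,x)K(u,y)`), and let the
outer values `H_i ≥ 0` have symmetrised oscillation `≤ M` on `T`
(`|H₁(x)H₂(y) − H₁(y)H₂(x)| ≤ M (H₁(x)H₂(y) + H₁(y)H₂(x))`). Then on `S` the oscillation of
`(h₁, h₂)` is at most `k M`, `k = (C−1)/(C+1)`:
`|h₁(u)h₂(v) − h₁(v)h₂(u)| ≤ k M (h₁(u)h₂(v) + h₁(v)h₂(u))`. Proof as printed: expand the four
products, symmetrise in `(x, y)`, and bound `|K(u,x)K(v,y) − K(v,x)K(u,y)| ≤ k (K(u,x)K(v,y) +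
K(v,x)K(u,y))` (`abs_sub_le_of_le_mul_of_le_mul`).
[cite: ChelkakWan2021, proof of Lemma 3.7] -/
theorem crossDiff_contraction (S : Set ι) (T : Finset κ) (K : ι → κ → ℝ) (H₁ H₂ : κ → ℝ)
    (h₁ h₂ : ι → ℝ) {C M : ℝ} (hC : 1 ≤ C)
    (hK : ∀ u ∈ S, ∀ x ∈ T, 0 ≤ K u x) (hH₁ : ∀ x ∈ T, 0 ≤ H₁ x) (hH₂ : ∀ x ∈ T, 0 ≤ H₂ x)
    (hrep₁ : ∀ u ∈ S, h₁ u = ∑ x ∈ T, K u x * H₁ x)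
    (hrep₂ : ∀ u ∈ S, h₂ u = ∑ x ∈ T, K u x * H₂ x)
    (hcross : ∀ u ∈ S, ∀ v ∈ S, ∀ x ∈ T, ∀ y ∈ T, K u x * K v y ≤ C * (K v x * K u y))
    (hout : ∀ x ∈ T, ∀ y ∈ T,
      |H₁ x * H₂ y - H₁ y * H₂ x| ≤ M * (H₁ x * H₂ y + H₁ y * H₂ x)) :
    ∀ u ∈ S, ∀ v ∈ S,
      |h₁ u * h₂ v - h₁ v * h₂ u| ≤ (C - 1) / (C + 1) * M * (h₁ u * h₂ v + h₁ v * h₂ u) := by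
  intro u hu v hv
  set k : ℝ := (C - 1) / (C + 1) with hk
  have hk0 : 0 ≤ k := div_nonneg (by linarith) (by linarith)
  -- the four products as double sums over `T × T`
  set a : κ → κ → ℝ := fun x y => K u x * K v y with ha
  have hA : h₁ u * h₂ v = ∑ x ∈ T, ∑ y ∈ T, a x y * (H₁ x * H₂ y) := by
    rw [hrep₁ u hu, hrep₂ v hv, Finset.sum_mul_sum]
    refine Finset.sum_congr rfl fun x _ => Finset.sum_congr rfl fun y _ => ?_
    simp only [ha]; ring
  have hB : h₁ v * h₂ u = ∑ x ∈ T, ∑ y ∈ T, a y x * (H₁ x * H₂ y) := by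
    rw [hrep₁ v hv, hrep₂ u hu, Finset.sum_mul_sum]
    refine Finset.sum_congr rfl fun x _ => Finset.sum_congr rfl fun y _ => ?_
    simp only [ha]; ring
  -- the same two products with the roles of `x` and `y` exchanged
  have hA' : h₁ u * h₂ v = ∑ x ∈ T, ∑ y ∈ T, a y x * (H₁ y * H₂ x) := by
    rw [hA, Finset.sum_comm]
  have hB' : h₁ v * h₂ u = ∑ x ∈ T, ∑ y ∈ T, a x y * (H₁ y * H₂ x) := by
    rw [hB, Finset.sum_comm]
  -- twice the difference, symmetrised
  have hdiff : 2 * (h₁ u * h₂ v - h₁ v * h₂ u) =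
      ∑ x ∈ T, ∑ y ∈ T, (a x y - a y x) * (H₁ x * H₂ y - H₁ y * H₂ x) := by
    have e : 2 * (h₁ u * h₂ v - h₁ v * h₂ u) =
        (h₁ u * h₂ v - h₁ v * h₂ u) + (h₁ u * h₂ v - h₁ v * h₂ u) := by ring
    rw [e]
    nth_rewrite 1 [hA, hB]
    rw [hA', hB', ← Finset.sum_sub_distrib, ← Finset.sum_sub_distrib, ← Finset.sum_add_distrib]
    refine Finset.sum_congr rfl fun x _ => ?_
    rw [← Finset.sum_sub_distrib, ← Finset.sum_sub_distrib, ← Finset.sum_add_distrib]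
    refine Finset.sum_congr rfl fun y _ => ?_
    ring
  -- twice the sum
  have hsum : 2 * (h₁ u * h₂ v + h₁ v * h₂ u) =
      ∑ x ∈ T, ∑ y ∈ T, (a x y + a y x) * (H₁ x * H₂ y + H₁ y * H₂ x) := by
    have e : 2 * (h₁ u * h₂ v + h₁ v * h₂ u) =
        (h₁ u * h₂ v + h₁ v * h₂ u) + (h₁ u * h₂ v + h₁ v * h₂ u) := by ring
    rw [e]
    nth_rewrite 1 [hA, hB]
    rw [hA', hB', ← Finset.sum_add_distrib, ← Finset.sum_add_distrib, ← Finset.sum_add_distrib]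
    refine Finset.sum_congr rfl fun x _ => ?_
    rw [← Finset.sum_add_distrib, ← Finset.sum_add_distrib, ← Finset.sum_add_distrib]
    refine Finset.sum_congr rfl fun y _ => ?_
    ring
  -- termwise bound
  have hterm : ∀ x ∈ T, ∀ y ∈ T,
      |(a x y - a y x) * (H₁ x * H₂ y - H₁ y * H₂ x)| ≤
        k * M * ((a x y + a y x) * (H₁ x * H₂ y + H₁ y * H₂ x)) := by
    intro x hx y hy
    have haxy : 0 ≤ a x y := mul_nonneg (hK u hu x hx) (hK v hv y hy)
    have hayx : 0 ≤ a y x := mul_nonneg (hK u hu y hy) (hK v hv x hx)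
    have h1 : |a x y - a y x| ≤ k * (a x y + a y x) := by
      refine abs_sub_le_of_le_mul_of_le_mul hC ?_ ?_
      · simp only [ha]
        rw [mul_comm (K u y) (K v x)]
        exact hcross u hu v hv x hx y hy
      · simp only [ha]
        rw [mul_comm (K u x) (K v y)]
        exact hcross u hu v hv y hy x hx
    have h2 := hout x hx y hy
    have hHxy : 0 ≤ H₁ x * H₂ y + H₁ y * H₂ x :=
      add_nonneg (mul_nonneg (hH₁ x hx) (hH₂ y hy)) (mul_nonneg (hH₁ y hy) (hH₂ x hx))
    rw [abs_mul]
    calc |a x y - a y x| * |H₁ x * H₂ y - H₁ y * H₂ x|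
        ≤ k * (a x y + a y x) * (M * (H₁ x * H₂ y + H₁ y * H₂ x)) :=
          mul_le_mul h1 h2 (abs_nonneg _) (mul_nonneg hk0 (add_nonneg haxy hayx))
      _ = k * M * ((a x y + a y x) * (H₁ x * H₂ y + H₁ y * H₂ x)) := by ring
  -- assemble
  have h2 : |2 * (h₁ u * h₂ v - h₁ v * h₂ u)| ≤ k * M * (2 * (h₁ u * h₂ v + h₁ v * h₂ u)) := by
    rw [hdiff, hsum, Finset.mul_sum]
    refine (Finset.abs_sum_le_sum_abs _ _).trans (Finset.sum_le_sum fun x hx => ?_)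
    rw [Finset.mul_sum]
    exact (Finset.abs_sum_le_sum_abs _ _).trans (Finset.sum_le_sum fun y hy => hterm x hx y hy)
  rw [abs_mul, abs_of_pos (by norm_num : (0:ℝ) < 2)] at h2
  rw [hk] at h2 ⊢
  linarith

/-! ### Iteration along a chain of cross-cuts (Corollary 3.8) -/

/-- **Chelkak–Wan's iteration (Corollary 3.8, abstract form).** Let `h₁, h₂ ≥ 0` on regions
`S 0, S 1, …` and suppose that for every `j` the pair is represented on `S (j+1)` through its
values on a finite set `T j ⊆ S j`, `h_i(u) = Σ_{x ∈ T j} K_j(u,x) h_i(x)`, by a nonnegative kernel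
whose cross-ratios are bounded by `C ≥ 1`. Then on `S q` the symmetrised oscillation is at most
`k^q`, `k = (C−1)/(C+1)`: `|h₁(u)h₂(v) − h₁(v)h₂(u)| ≤ k^q (h₁(u)h₂(v) + h₁(v)h₂(u))`
("iterating `q` times the result of Lemma 3.7 (note that the ratio inside the absolute value is
always less than `1`)"). In the printed setting `S j = Θ^δ(2^{-j} r)` (with `S 0 ⊇ S^δ_o(b, r⁺)`),
`T j = S^δ_o(b, 2^{-j} r⁺)`, `K_j = Z_{Θ(2^{-j} r)}`. [cite: ChelkakWan2021, Corollary 3.8] -/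
theorem crossDiff_iterate (h₁ h₂ : ι → ℝ) (S : ℕ → Set ι) (T : ℕ → Finset ι)
    (K : ℕ → ι → ι → ℝ) {C : ℝ} (hC : 1 ≤ C)
    (hpos₁ : ∀ j, ∀ x ∈ S j, 0 ≤ h₁ x) (hpos₂ : ∀ j, ∀ x ∈ S j, 0 ≤ h₂ x)
    (hT : ∀ j, (↑(T j) : Set ι) ⊆ S j)
    (hK : ∀ j, ∀ u ∈ S (j + 1), ∀ x ∈ T j, 0 ≤ K j u x)
    (hrep₁ : ∀ j, ∀ u ∈ S (j + 1), h₁ u = ∑ x ∈ T j, K j u x * h₁ x)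
    (hrep₂ : ∀ j, ∀ u ∈ S (j + 1), h₂ u = ∑ x ∈ T j, K j u x * h₂ x)
    (hcross : ∀ j, ∀ u ∈ S (j + 1), ∀ v ∈ S (j + 1), ∀ x ∈ T j, ∀ y ∈ T j,
      K j u x * K j v y ≤ C * (K j v x * K j u y)) :
    ∀ q, ∀ u ∈ S q, ∀ v ∈ S q,
      |h₁ u * h₂ v - h₁ v * h₂ u| ≤ ((C - 1) / (C + 1)) ^ q * (h₁ u * h₂ v + h₁ v * h₂ u) := by
  intro q
  induction q with
  | zero =>
    intro u hu v hv
    rw [pow_zero]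
    exact abs_sub_le_one_mul_add (mul_nonneg (hpos₁ 0 u hu) (hpos₂ 0 v hv))
      (mul_nonneg (hpos₁ 0 v hv) (hpos₂ 0 u hu))
  | succ q ih =>
    intro u hu v hv
    have step := crossDiff_contraction (S (q + 1)) (T q) (K q) h₁ h₂ h₁ h₂ hC
      (hK q) (fun x hx => hpos₁ q x (hT q hx)) (fun x hx => hpos₂ q x (hT q hx)) (hrep₁ q)
      (hrep₂ q) (hcross q) (fun x hx y hy => ih x (hT q hx) y (hT q hy)) u hu v hv
    simpa only [pow_succ, mul_comm (((C - 1) / (C + 1)) ^ q)] using step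

/-- **Chelkak–Wan's Corollary 3.8, ratio form (abstract).** In the setting of `crossDiff_iterate`,
for `q ≥ 1` and points `u, v` of `S q` with `h₂(u), h₁(v) > 0`:
`(h₁(u)/h₂(u))/(h₁(v)/h₂(v)) ≤ (1 + k^q)/(1 − k^q)`, `k = (C−1)/(C+1) < 1`.
[cite: ChelkakWan2021, Corollary 3.8] -/
theorem crossDiff_iterate_ratio (h₁ h₂ : ι → ℝ) (S : ℕ → Set ι) (T : ℕ → Finset ι)
    (K : ℕ → ι → ι → ℝ) {C : ℝ} (hC : 1 ≤ C)
    (hpos₁ : ∀ j, ∀ x ∈ S j, 0 ≤ h₁ x) (hpos₂ : ∀ j, ∀ x ∈ S j, 0 ≤ h₂ x)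
    (hT : ∀ j, (↑(T j) : Set ι) ⊆ S j)
    (hK : ∀ j, ∀ u ∈ S (j + 1), ∀ x ∈ T j, 0 ≤ K j u x)
    (hrep₁ : ∀ j, ∀ u ∈ S (j + 1), h₁ u = ∑ x ∈ T j, K j u x * h₁ x)
    (hrep₂ : ∀ j, ∀ u ∈ S (j + 1), h₂ u = ∑ x ∈ T j, K j u x * h₂ x)
    (hcross : ∀ j, ∀ u ∈ S (j + 1), ∀ v ∈ S (j + 1), ∀ x ∈ T j, ∀ y ∈ T j,
      K j u x * K j v y ≤ C * (K j v x * K j u y))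
    {q : ℕ} (hq : 1 ≤ q) {u v : ι} (hu : u ∈ S q) (hv : v ∈ S q)
    (h₂u : 0 < h₂ u) (h₁v : 0 < h₁ v) :
    h₁ u / h₂ u / (h₁ v / h₂ v) ≤
      (1 + ((C - 1) / (C + 1)) ^ q) / (1 - ((C - 1) / (C + 1)) ^ q) := by
  have hk0 : 0 ≤ (C - 1) / (C + 1) := div_nonneg (by linarith) (by linarith)
  have hk1 : (C - 1) / (C + 1) < 1 := by
    rw [div_lt_one (by linarith)]; linarith
  have hkq : ((C - 1) / (C + 1)) ^ q < 1 := pow_lt_one₀ hk0 hk1 (by omega)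
  have main := crossDiff_iterate h₁ h₂ S T K hC hpos₁ hpos₂ hT hK hrep₁ hrep₂ hcross q u hu v hv
  exact div_div_le_of_abs_sub_le h₂u h₁v hkq main

end BoundaryHarnackContraction

end Literature.Probability.LatticeModels
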